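import Summits.BirchSwinnertonDyer.BirchSwinnertonDyer.Theorems.RamifiedHeegnerPairLeafRankOneUpperAtThreeShimuraInertPairingCore
import Summits.BirchSwinnertonDyer.BirchSwinnertonDyer.Theorems.RamifiedHeegnerPairLeafRankZeroUpperAtThreeShimuraInertVariants
import HarnessLib

/-!
# Route `RamifiedHeegnerPair`, crux U₁ `LeafRankOneUpperAtThree` (stmt-BirchSwinnertonDyer-26022), line `splitkolyvagin` —
# the INERT-CARRIER (Shimura-curve) road, part 10: the PAIRING-Shimura rows (full Papikian–Rabinoff, `q = 2` allowed) —
# supply from the named facts ∧ L₀, the weakening Σ★⁵ ⟹ Σ★⁶, and THE COMPOSITION of skeleton v11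

HONEST FRAMING. Theorems only; helper file (`--supports stmt-BirchSwinnertonDyer-26022 --as helper`); nothing is booked, no item is
closed, BSD is not proved for any curve; CONDITIONAL on every displayed input. Lead prover bsd-line-rhp-p2 g10, 2026-08-28.

A «PAIRING-Shimura row» is a Shimura row (datum constant a `3`-unit; SHAPE «`3 ∣ c_q ⇒ q` split multiplicative»; an even set `S` of
multiplicative primes holding every split-multiplicative carrier) whose (DEG)-availability is one of: a (ram) witness in `S` (Pasten Lemma
6.15) | two outside multiplicative primes one of them a witness (Lemma 6.16) | a subset `R ⊆ S` of half the size each of whose members is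
`2` or a prime `q` with `3 ∤ q − 1` (Lemma 6.18 in FULL, Papikian–Rabinoff pairing; part 9's core). Every Shimura row of parts 3–8 (third
mechanism: a PAIR `{q₁,q₂}` with `q₂` odd, `q₂ ≢ 1 (mod 3)`) is a pairing-Shimura row (`pairingRow_of_pairRow`), so Σ★⁶ := Σ★‴ OFF the
pairing-Shimura rows is WEAKER than Σ★⁵ (`sigmaStarOptOffPairingRows_of_sigmaStarOptOffShimuraRowsAny`; chain 27493 ⟹ Σ★‴ ⟹ Σ★⁗ ⟹ Σ★⁵ ⟹ Σ★⁶
by name). Census (rank-one Gss2, `N < 5·10⁵`): pairing-Shimura rows 123 of the 238 multi-carrier classes (Shimura rows of v10: 116), so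
Σ★⁶'s content = 115 (109 with an additive `IV/IV*` carrier + 6 with both carriers `≡ 1 (mod 3)`).

* `leafRankOneUpper_three_of_shimuraInert_of_lowerRankZero_pairing` — U₁ at a leaf curve on a pairing-Shimura row ⟸ {GZK, modularity ×2,
  JL, Pasten §6 CO (full 6.18), CST14+JSW17 on `X_{N⁺,N⁻}`, FH inert-split} ∧ L₀ — no Σ.
* `pairingRow_of_pairRow`, `sigmaStarOptOffPairingRows_of_sigmaStarOptOffShimuraRowsAny` (Σ★⁵ ⟹ Σ★⁶).
* `leafRankOneUpperAtThree_of_pubManin_of_namedFacts_of_shimuraFactsSplit_of_sigmaStarOptOffPairingRows_of_lowerRankZero` — the v11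
  composition: PUB⁺ → F1 → F2 → F3 → (JL, CO, HK, FH-splitAt) → Σ★⁶ → L₀ → `LeafRankOneUpperAtThree`.
  -- adapted from Summits/BirchSwinnertonDyer/BirchSwinnertonDyer/Theorems/RamifiedHeegnerPairLeafRankOneUpperAtThreeShimuraInertComposition.lean

References: [cite: PastenShimura2024, Prop. 6.13, Lemmas 6.15–6.16, Lemma 6.18 (p. 24), §6.9] [cite: PapikianRabinoff2016, Cor. 3.5]
[cite: JetchevSkinnerWan2017, §7.4.2 (p. 31), Thm. 4.4.1 (p. 19)] [cite: CaiShuTian2014, Thm. 1.5] [cite: FriedbergHoffstein1995, Thm. B]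
[cite: Jetchev2008, Conj. 1.3, Thm. 1.4 (p. 812)] [cite: Miller2011LMS, Def. 1.1].
-/

-- D-0017: single-problem summit, so `Summit.BirchSwinnertonDyer.BirchSwinnertonDyer.…` repeats a namespace BY DESIGN.
set_option linter.dupNamespace false
set_option autoImplicit false

noncomputable section

open scoped Classical NumberField

open WeierstrassCurve NumberField IsDedekindDomain Literature Literature.NumberTheory.EllipticCurves
  Rat.HeightOneSpectrum CongruenceSubgroup
  Literature.NumberTheory.EllipticCurves.ModularForms
  Literature.NumberTheory.EllipticCurves.Rank1Residual
  Literature.NumberTheory.EllipticCurves.Rank1Residual.Typed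
  Literature.NumberTheory.QuadraticFields.Quadratic
  Literature.NumberTheory.GaloisCohomology
  Literature.NumberTheory.Automorphic
  Summit.BirchSwinnertonDyer.Rank1Residual
  Summit.BirchSwinnertonDyer.Rank1Residual.Additive
  Summit.BirchSwinnertonDyer.Rank1Residual.X11b
  Summit.BirchSwinnertonDyer.Rank1Residual.X11b.Three
  Summit.BirchSwinnertonDyer.BirchSwinnertonDyer.Theses.RamifiedHeegnerPair
  Summit.BirchSwinnertonDyer.BirchSwinnertonDyer.Theorems
  Summit.BirchSwinnertonDyer.BirchSwinnertonDyer.Theorems.RamifiedPairUpperBound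

namespace Summit.BirchSwinnertonDyer.BirchSwinnertonDyer.Theorems.LeafShimuraInert

/-! ## §10.1 U₁ on a pairing-Shimura row from the named facts and L₀ -/

/-- **U₁ AT A LEAF CURVE ON A PAIRING-SHIMURA ROW, from PUBLISHED named facts and L₀ — no Σ.** For `W/ℚ` globally minimal, non-CM,
additive of cell `(G) ∧ ss` at `3`, `r_an = 1`, carrying a datum with `3 ∤ c`; an even set `S` of multiplicative primes holding every
split-multiplicative carrier, SHAPE, and (DEG)-availability in the PAIRING form (part 9): `Typed.MissingUpperBoundAt W 3` from {GZK,
modularity ×2, Jacquet–Langlands, Pasten 2024 §6 component orders (Lemma 6.18 in full), `shimuraCurve_heegnerPoint_grossZagier_kolyvagin`,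
`friedbergHoffstein_exists_twist_ne_zero_inertAt_splitAt`} and the route member L₀ `Gss2LowerAtThreeRankZero`. Field: sign `−1`, `S` inert,
every other bad prime split, `2` split unless in `S` (so `d_K` odd); Heegner datum by `shimuraHeegnerAt_of_fact`; core = part 9; partner
lower by `partnerLowerSplitThree_of_lowerRankZero`. CONDITIONAL; nothing booked; U₁ / L₀ OPEN; BSD is not proved.
[cite: FriedbergHoffstein1995, Thm. B] [cite: JetchevSkinnerWan2017, §7.4.2, Thm. 4.4.1] [cite: CaiShuTian2014, Thm. 1.5]
[cite: PastenShimura2024, Prop. 6.13, Lemmas 6.15–6.16, 6.18] [cite: PapikianRabinoff2016, Cor. 3.5] [cite: Miller2011LMS, Def. 1.1] -/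
theorem leafRankOneUpper_three_of_shimuraInert_of_lowerRankZero_pairing
    -- published inputs (named facts of the tree)
    (hGZK : rank_eq_analyticRank_of_analyticRank_le_one) (hmod : hasEntireLFunction_rat)
    (hnf : exists_isNewformOf) (hJL : nonempty_shimuraParametrizationData)
    (hCO : PastenShimura2024_componentOrders)
    (hHK : shimuraCurve_heegnerPoint_grossZagier_kolyvagin)
    (hFH2 : friedbergHoffstein_exists_twist_ne_zero_inertAt_splitAt)
    -- the route member L₀ BY NAME
    (hL0 : Summit.BirchSwinnertonDyer.BirchSwinnertonDyer.Theses.RamifiedHeegnerPair.Gss2LowerAtThreeRankZero)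
    -- the leaf curve (`r_an = 1`), with a datum whose constant is a `3`-unit
    (W : WeierstrassCurve ℚ) [W.IsElliptic] [W.IsGloballyMinimal]
    (hCM : ¬ W.HasCM) (hadd : Addv W 3) (hsub : SubGss W 3) (hr : W.analyticRank = 1)
    {N : ℕ} [NeZero N] (hN : W.conductorNorm ℤ = N)
    (Dt : ModularParametrizationData W N) (hc : ¬ (3 : ℤ) ∣ Dt.c)
    -- the inert set, SHAPE and (DEG)-availability (pairing form)
    (S : Finset ℕ) (hSeven : Even S.card)
    (hSmult : ∀ ℓ ∈ S, ∃ _ : Fact ℓ.Prime, W.HasMultiplicativeReductionAtPrime ℓ)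
    (hFC : ∀ (ℓ : ℕ) [Fact ℓ.Prime], ℓ ∉ S → W.HasSplitMultiplicativeReductionAtPrime ℓ →
      ¬ 3 ∣ padicValInt ℓ W.minimalDiscriminantInt)
    (hshape : ∀ (q : ℕ) [Fact q.Prime], 3 ∣ (W.baseChange ℚ_[q]).localTamagawaNumber ℤ_[q] →
      W.HasSplitMultiplicativeReductionAtPrime q)
    (hDEG : (∃ ℓ₀ ∈ S, ¬ 3 ∣ padicValInt ℓ₀ W.minimalDiscriminantInt) ∨
      (∃ ℓ₀ t : ℕ, ∃ _ : Fact ℓ₀.Prime, ∃ _ : Fact t.Prime,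
        W.HasMultiplicativeReductionAtPrime ℓ₀ ∧ W.HasMultiplicativeReductionAtPrime t ∧
        ℓ₀ ∉ S ∧ t ∉ S ∧ t ≠ ℓ₀ ∧ ¬ 3 ∣ padicValInt ℓ₀ W.minimalDiscriminantInt) ∨
      (∃ R : Finset ℕ, R ⊆ S ∧ 2 * R.card = S.card ∧ ∀ q ∈ R, q = 2 ∨ ¬ 3 ∣ q - 1)) :
    Typed.MissingUpperBoundAt W 3 := by
  haveI h3F : Fact (Nat.Prime 3) := ⟨Nat.prime_three⟩
  subst hN
  have hirr : W.HasIrreducibleModPGaloisRep 3 := Additive.irr_of_subGss_of_ne_two W 3 (by decide) hadd hsub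
  -- the sign of the functional equation is `−1` (modularity, `r_an = 1`)
  have hw : W.rootNumber = -1 := by
    rw [WeierstrassCurve.rootNumber_eq_neg_one_pow_analyticRank_of_exists_isNewformOf hnf W, hr]
    norm_num
  -- the field of JSW §7.4.2 with `2` split unless inert
  obtain ⟨K, _, _, hK, -, hinert, hsplitN, hsplit2, hLt⟩ := hFH2 W hw S hSmult hSeven 2 two_ne_zero 4
  have hodd : Odd (NumberField.discr K) := by
    by_cases h2S : 2 ∈ S
    · obtain ⟨hn, hd⟩ := hinert 2 h2S
      exact odd_discr_of_two_inert_or_split hK.1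
        (Or.inl ⟨by simpa only [Nat.cast_ofNat] using hn, by simpa only [Nat.cast_ofNat] using hd⟩)
    · have hn := hsplit2 2 Nat.prime_two (dvd_refl 2) h2S
      exact odd_discr_of_two_inert_or_split hK.1 (Or.inr (by simpa only [Nat.cast_ofNat] using hn))
  obtain ⟨-, hps2, hH3, hSin⟩ := jswField_localData W hadd S hSmult K hinert hsplitN
  exact leafRankOneUpper_three_of_shimuraInertDatum_at_pairing hGZK hmod hnf hJL hCO W hadd hsub hr rfl Dt hc S hSeven hSmult hFC
    hshape hDEG K hK hodd hinert hsplitN hLt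
    (shimuraHeegnerAt_of_fact W rfl K hK S hSeven hSin hsplitN hps2 Dt hHK hirr)
    (fun Wd _ _ Cd hWd ↦ partnerLowerSplitThree_of_lowerRankZero hmod hL0 W hCM hadd hsub K hK hodd hH3 hLt Wd Cd hWd)

/-! ## §10.2 Pair rows are pairing rows; Σ★⁵ ⟹ Σ★⁶ -/

/-- A PAIR `S = {q₁, q₂}` of multiplicative primes with `q₂` odd and `q₂ ≢ 1 (mod 3)` is a pairing datum: `R = {q₂}` has half the size of
`S` and `3 ∤ q₂ − 1` (as `q₂ ≥ 2` is prime). So the Shimura rows of parts 3–8 are pairing-Shimura rows. [folklore] -/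
theorem pairingRow_of_pairRow {W : WeierstrassCurve ℚ} {S : Finset ℕ}
    (hSmult : ∀ ℓ ∈ S, ∃ _ : Fact ℓ.Prime, W.HasMultiplicativeReductionAtPrime ℓ)
    (h : ∃ q₁ q₂ : ℕ, S = {q₁, q₂} ∧ q₁ ≠ q₂ ∧ q₂ ≠ 2 ∧ q₂ % 3 ≠ 1) :
    ∃ R : Finset ℕ, R ⊆ S ∧ 2 * R.card = S.card ∧ ∀ q ∈ R, q = 2 ∨ ¬ 3 ∣ q - 1 := by
  obtain ⟨q₁, q₂, hS, hne, -, hq₂1⟩ := h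
  obtain ⟨hF, -⟩ := hSmult q₂ (by rw [hS]; simp)
  have h2 : 2 ≤ q₂ := hF.out.two_le
  refine ⟨{q₂}, by rw [hS]; simp, by rw [hS, Finset.card_pair hne]; simp, fun q hq ↦ ?_⟩
  rw [Finset.mem_singleton.mp hq]
  right
  intro h3
  omega

/-- **Σ★⁵ ⟹ Σ★⁶** (weakening: Σ★⁶ is Σ★⁵ with the third (DEG) disjunct of the negated Shimura-row clause replaced by the PAIRING form, which
every pair datum satisfies (`pairingRow_of_pairRow`); so the Σ★⁶ clause excludes more rows, and given the data of a Σ★⁶ instance the Σ★⁵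
binder is available). Chain of record: 27493 ⟹ Σ★‴ ⟹ Σ★⁗ ⟹ Σ★⁵ ⟹ Σ★⁶ by name. [cite: Jetchev2008, Conj. 1.3 (p. 812)] -/
theorem sigmaStarOptOffPairingRows_of_sigmaStarOptOffShimuraRowsAny
    (hStar : ∀ (W : WeierstrassCurve ℚ) [W.IsElliptic] [W.IsGloballyMinimal] (N : ℕ) [NeZero N]
      (K : Type) [Field K] [NumberField K]
      (Dt : ModularParametrizationData W N) (H : HeegnerDatum N (NumberField.discr K)) (ι : K →+* ℂ)
      (P : (W.baseChange K).toAffine.Point),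
      ¬ W.HasCM → Addv W 3 → SubGss W 3 → W.conductorNorm ℤ = N →
      (∀ z ∈ Dt.L.lattice, ∃ w ∈ periodLattice Dt.f, z = Dt.c * w) →
      ¬ (∃ (q : ℕ) (_ : Fact q.Prime), q ∣ N ∧
          padicValNat 3 W.tamagawaProduct ≤ padicValNat 3 ((W.baseChange ℚ_[q]).localTamagawaNumber ℤ_[q])) →
      ¬ ((∀ (q : ℕ) [Fact q.Prime], 3 ∣ (W.baseChange ℚ_[q]).localTamagawaNumber ℤ_[q] →
            W.HasSplitMultiplicativeReductionAtPrime q) ∧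
          ∃ S : Finset ℕ, Even S.card ∧ (∀ ℓ ∈ S, ∃ _ : Fact ℓ.Prime, W.HasMultiplicativeReductionAtPrime ℓ) ∧
            (∀ (ℓ : ℕ) [Fact ℓ.Prime], ℓ ∉ S → W.HasSplitMultiplicativeReductionAtPrime ℓ →
              ¬ 3 ∣ padicValInt ℓ W.minimalDiscriminantInt) ∧
            ((∃ ℓ₀ ∈ S, ¬ 3 ∣ padicValInt ℓ₀ W.minimalDiscriminantInt) ∨
              (∃ ℓ₀ t : ℕ, ∃ _ : Fact ℓ₀.Prime, ∃ _ : Fact t.Prime,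
                W.HasMultiplicativeReductionAtPrime ℓ₀ ∧ W.HasMultiplicativeReductionAtPrime t ∧
                ℓ₀ ∉ S ∧ t ∉ S ∧ t ≠ ℓ₀ ∧ ¬ 3 ∣ padicValInt ℓ₀ W.minimalDiscriminantInt) ∨
              (∃ q₁ q₂ : ℕ, S = {q₁, q₂} ∧ q₁ ≠ q₂ ∧ q₂ ≠ 2 ∧ q₂ % 3 ≠ 1))) →
      IsImaginaryQuadratic K → SatisfiesHeegnerHypothesis N K →
      (WeierstrassCurve.Affine.Point.map ι.toRatAlgHom) P = heegnerPointComplex Dt H →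
      ¬ IsOfFinAddOrder P → Odd (NumberField.discr K) →
      ∀ (s' : ℕ), s' ≤ padicValNat 3 W.tamagawaProduct + padicValNat 3 Dt.c.natAbs →
      ∀ (n : ℕ) (d : KolyvaginHeegnerData Dt H.β ι n), Squarefree n →
      (∀ ℓ ∈ n.primeFactors, Zhang2014.IsKolyvaginPrime N W K 3 ℓ ∧ s' ≤ Zhang2014.kolyvaginIndex W 3 ℓ) →
      Koly.PDiv d 3 s') :
    ∀ (W : WeierstrassCurve ℚ) [W.IsElliptic] [W.IsGloballyMinimal] (N : ℕ) [NeZero N]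
      (K : Type) [Field K] [NumberField K]
      (Dt : ModularParametrizationData W N) (H : HeegnerDatum N (NumberField.discr K)) (ι : K →+* ℂ)
      (P : (W.baseChange K).toAffine.Point),
      ¬ W.HasCM → Addv W 3 → SubGss W 3 → W.conductorNorm ℤ = N →
      (∀ z ∈ Dt.L.lattice, ∃ w ∈ periodLattice Dt.f, z = Dt.c * w) →
      ¬ (∃ (q : ℕ) (_ : Fact q.Prime), q ∣ N ∧
          padicValNat 3 W.tamagawaProduct ≤ padicValNat 3 ((W.baseChange ℚ_[q]).localTamagawaNumber ℤ_[q])) →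
      ¬ ((∀ (q : ℕ) [Fact q.Prime], 3 ∣ (W.baseChange ℚ_[q]).localTamagawaNumber ℤ_[q] →
            W.HasSplitMultiplicativeReductionAtPrime q) ∧
          ∃ S : Finset ℕ, Even S.card ∧ (∀ ℓ ∈ S, ∃ _ : Fact ℓ.Prime, W.HasMultiplicativeReductionAtPrime ℓ) ∧
            (∀ (ℓ : ℕ) [Fact ℓ.Prime], ℓ ∉ S → W.HasSplitMultiplicativeReductionAtPrime ℓ →
              ¬ 3 ∣ padicValInt ℓ W.minimalDiscriminantInt) ∧
            ((∃ ℓ₀ ∈ S, ¬ 3 ∣ padicValInt ℓ₀ W.minimalDiscriminantInt) ∨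
              (∃ ℓ₀ t : ℕ, ∃ _ : Fact ℓ₀.Prime, ∃ _ : Fact t.Prime,
                W.HasMultiplicativeReductionAtPrime ℓ₀ ∧ W.HasMultiplicativeReductionAtPrime t ∧
                ℓ₀ ∉ S ∧ t ∉ S ∧ t ≠ ℓ₀ ∧ ¬ 3 ∣ padicValInt ℓ₀ W.minimalDiscriminantInt) ∨
              (∃ R : Finset ℕ, R ⊆ S ∧ 2 * R.card = S.card ∧ ∀ q ∈ R, q = 2 ∨ ¬ 3 ∣ q - 1))) →
      IsImaginaryQuadratic K → SatisfiesHeegnerHypothesis N K →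
      (WeierstrassCurve.Affine.Point.map ι.toRatAlgHom) P = heegnerPointComplex Dt H →
      ¬ IsOfFinAddOrder P → Odd (NumberField.discr K) →
      ∀ (s' : ℕ), s' ≤ padicValNat 3 W.tamagawaProduct + padicValNat 3 Dt.c.natAbs →
      ∀ (n : ℕ) (d : KolyvaginHeegnerData Dt H.β ι n), Squarefree n →
      (∀ ℓ ∈ n.primeFactors, Zhang2014.IsKolyvaginPrime N W K 3 ℓ ∧ s' ≤ Zhang2014.kolyvaginIndex W 3 ℓ) →
      Koly.PDiv d 3 s' := by
  intro W _ _ N _ K _ _ Dt H ι P hCM hadd hsub hN hopt hrow hSh hK hHN hP hnt hodd s' hs' n d hn hℓ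
  refine hStar W N K Dt H ι P hCM hadd hsub hN hopt hrow ?_ hK hHN hP hnt hodd s' hs' n d hn hℓ
  rintro ⟨hshape, S, hSeven, hSmult, hFC, hDEG⟩
  apply hSh
  refine ⟨hshape, S, hSeven, hSmult, hFC, ?_⟩
  rcases hDEG with h₁ | h₂ | h₃
  · exact Or.inl h₁
  · exact Or.inr (Or.inl h₂)
  · exact Or.inr (Or.inr (pairingRow_of_pairRow hSmult h₃))

/-! ## §10.3 The composition of skeleton v11 -/

/-- **`LeafRankOneUpperAtThree` ⟸ PUB⁺ ∧ F1–F3 ∧ SHIMURA FACTS (split supply) ∧ Σ★⁶ ∧ L₀ — the composition of skeleton v11**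
(conclusion literally the route decl). Part 5's v10 composition VERBATIM with the Shimura branch cut by the PAIRING clause and served by
`leafRankOneUpper_three_of_shimuraInert_of_lowerRankZero_pairing`. Proof: optimal member `W₀ ∼ W`; at `W₀`: pairing-Shimura row ⇒ §10.1;
else mono-carrier row ⇒ the any-carrier reading from F1–F3; else Σ★⁶ at the datum; transport back (Cassels + GZK). CONDITIONAL on every
displayed input; U₁ stays OPEN; BSD is not proved.
-- adapted from Summits/BirchSwinnertonDyer/BirchSwinnertonDyer/Theorems/RamifiedHeegnerPairLeafRankOneUpperAtThreeShimuraInertComposition.lean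
[cite: JetchevSkinnerWan2017, §7.4.2 (p. 31), Thm. 4.4.1 (p. 19)] [cite: CaiShuTian2014, Thm. 1.5]
[cite: PastenShimura2024, Prop. 6.13, Lemmas 6.15–6.16, 6.18 (pp. 23–25)] [cite: PapikianRabinoff2016, Cor. 3.5]
[cite: Jetchev2008, Conj. 1.3, Thm. 1.4 (p. 812)] [cite: GrossLMS1991, Prop. 3.7 (2) (p. 240)] [cite: MatarNekovar2019, Thm. 0.7 (p. 456)] -/
theorem leafRankOneUpperAtThree_of_pubManin_of_namedFacts_of_shimuraFactsSplit_of_sigmaStarOptOffPairingRows_of_lowerRankZero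
    (hpub : LeafRankOnePrintedInputsAtThree)
    (h37 : GrossLMS1991.prop37_2_frobeniusCongruence)
    (hPT : ∀ (K : Type) [Field K] [NumberField K],
      Literature.NumberTheory.GaloisCohomology.poitouTate_selmerStructure_duality_conj K)
    (hF1 : Gross1991_heegnerPoint_sub_ratTorsion_mem_E0_imageFree)
    (hJL : nonempty_shimuraParametrizationData) (hCO : PastenShimura2024_componentOrders)
    (hHK : shimuraCurve_heegnerPoint_grossZagier_kolyvagin)
    (hFH2 : friedbergHoffstein_exists_twist_ne_zero_inertAt_splitAt)
    (hStar : ∀ (W : WeierstrassCurve ℚ) [W.IsElliptic] [W.IsGloballyMinimal] (N : ℕ) [NeZero N]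
      (K : Type) [Field K] [NumberField K]
      (Dt : ModularParametrizationData W N) (H : HeegnerDatum N (NumberField.discr K)) (ι : K →+* ℂ)
      (P : (W.baseChange K).toAffine.Point),
      ¬ W.HasCM → Addv W 3 → SubGss W 3 → W.conductorNorm ℤ = N →
      (∀ z ∈ Dt.L.lattice, ∃ w ∈ periodLattice Dt.f, z = Dt.c * w) →
      ¬ (∃ (q : ℕ) (_ : Fact q.Prime), q ∣ N ∧
          padicValNat 3 W.tamagawaProduct ≤ padicValNat 3 ((W.baseChange ℚ_[q]).localTamagawaNumber ℤ_[q])) →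
      ¬ ((∀ (q : ℕ) [Fact q.Prime], 3 ∣ (W.baseChange ℚ_[q]).localTamagawaNumber ℤ_[q] →
            W.HasSplitMultiplicativeReductionAtPrime q) ∧
          ∃ S : Finset ℕ, Even S.card ∧ (∀ ℓ ∈ S, ∃ _ : Fact ℓ.Prime, W.HasMultiplicativeReductionAtPrime ℓ) ∧
            (∀ (ℓ : ℕ) [Fact ℓ.Prime], ℓ ∉ S → W.HasSplitMultiplicativeReductionAtPrime ℓ →
              ¬ 3 ∣ padicValInt ℓ W.minimalDiscriminantInt) ∧
            ((∃ ℓ₀ ∈ S, ¬ 3 ∣ padicValInt ℓ₀ W.minimalDiscriminantInt) ∨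
              (∃ ℓ₀ t : ℕ, ∃ _ : Fact ℓ₀.Prime, ∃ _ : Fact t.Prime,
                W.HasMultiplicativeReductionAtPrime ℓ₀ ∧ W.HasMultiplicativeReductionAtPrime t ∧
                ℓ₀ ∉ S ∧ t ∉ S ∧ t ≠ ℓ₀ ∧ ¬ 3 ∣ padicValInt ℓ₀ W.minimalDiscriminantInt) ∨
              (∃ R : Finset ℕ, R ⊆ S ∧ 2 * R.card = S.card ∧ ∀ q ∈ R, q = 2 ∨ ¬ 3 ∣ q - 1))) →
      IsImaginaryQuadratic K → SatisfiesHeegnerHypothesis N K →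
      (WeierstrassCurve.Affine.Point.map ι.toRatAlgHom) P = heegnerPointComplex Dt H →
      ¬ IsOfFinAddOrder P → Odd (NumberField.discr K) →
      ∀ (s' : ℕ), s' ≤ padicValNat 3 W.tamagawaProduct + padicValNat 3 Dt.c.natAbs →
      ∀ (n : ℕ) (d : KolyvaginHeegnerData Dt H.β ι n), Squarefree n →
      (∀ ℓ ∈ n.primeFactors, Zhang2014.IsKolyvaginPrime N W K 3 ℓ ∧ s' ≤ Zhang2014.kolyvaginIndex W 3 ℓ) →
      Koly.PDiv d 3 s')
    (hL0 : Gss2LowerAtThreeRankZero) :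
    LeafRankOneUpperAtThree := by
  intro W _ _ hCM hadd hsub hr
  obtain ⟨hGZ, hKo, hGZK, hmod, hGZ73, hMN, hnf, hFH, -, hCassels, hM, hAU, hC2⟩ := hpub
  haveI : Fact (Nat.Prime 3) := ⟨Nat.prime_three⟩
  have hR₂ := JetchevReadingAnyCarrier.anyCarrierTwoSplitReading_of_namedFacts h37 hPT hF1
  obtain ⟨W₀, hW₀, hW₀', N, hN0, D₀, hiso, hN₀, -, hopt, hCM₀, hadd₀, hsub₀, hr₀⟩ :=
    exists_optimal_leaf_member hnf W hCM hadd hsub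
  haveI := hW₀
  haveI := hW₀'
  haveI := hN0
  have hr₀' : W₀.analyticRank = 1 := hr₀.trans hr
  -- settle U₁ at the optimal member `W₀` by the three-way row split
  have h₀ : MissingUpperBoundAt W₀ 3 := by
    subst hN₀
    have hc : ¬ (3 : ℤ) ∣ D₀.c := not_three_dvd_c_of_latticeOptimal_of_subGss hM hAU hC2 hnf W₀ D₀ hopt hadd₀ hsub₀
    by_cases hSh : ((∀ (q : ℕ) [Fact q.Prime], 3 ∣ (W₀.baseChange ℚ_[q]).localTamagawaNumber ℤ_[q] →
            W₀.HasSplitMultiplicativeReductionAtPrime q) ∧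
          ∃ S : Finset ℕ, Even S.card ∧ (∀ ℓ ∈ S, ∃ _ : Fact ℓ.Prime, W₀.HasMultiplicativeReductionAtPrime ℓ) ∧
            (∀ (ℓ : ℕ) [Fact ℓ.Prime], ℓ ∉ S → W₀.HasSplitMultiplicativeReductionAtPrime ℓ →
              ¬ 3 ∣ padicValInt ℓ W₀.minimalDiscriminantInt) ∧
            ((∃ ℓ₀ ∈ S, ¬ 3 ∣ padicValInt ℓ₀ W₀.minimalDiscriminantInt) ∨
              (∃ ℓ₀ t : ℕ, ∃ _ : Fact ℓ₀.Prime, ∃ _ : Fact t.Prime,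
                W₀.HasMultiplicativeReductionAtPrime ℓ₀ ∧ W₀.HasMultiplicativeReductionAtPrime t ∧
                ℓ₀ ∉ S ∧ t ∉ S ∧ t ≠ ℓ₀ ∧ ¬ 3 ∣ padicValInt ℓ₀ W₀.minimalDiscriminantInt) ∨
              (∃ R : Finset ℕ, R ⊆ S ∧ 2 * R.card = S.card ∧ ∀ q ∈ R, q = 2 ∨ ¬ 3 ∣ q - 1)))
    · -- a pairing-Shimura row: the inert-carrier road (§10.1), no Σ
      obtain ⟨hshape, S, hSeven, hSmult, hFC, hDEG⟩ := hSh
      exact leafRankOneUpper_three_of_shimuraInert_of_lowerRankZero_pairing hGZK hmod hnf hJL hCO hHK hFH2 hL0 W₀ hCM₀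
        hadd₀ hsub₀ hr₀' rfl D₀ hc S hSeven hSmult hFC hshape hDEG
    · by_cases hrow : ∃ (q : ℕ) (_ : Fact q.Prime), q ∣ W₀.conductorNorm ℤ ∧
          padicValNat 3 W₀.tamagawaProduct ≤ padicValNat 3 ((W₀.baseChange ℚ_[q]).localTamagawaNumber ℤ_[q])
      · -- a mono-carrier row: the any-carrier reading from F1–F3
        obtain ⟨q, _, hqN, hmono⟩ := hrow
        exact leafRankOneUpper_three_monoCarrierAny_of_anyCarrierReading_of_lowerRankZero hGZ hKo hGZK hmod hGZ73 hMN hnf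
          hFH hR₂ hL0 W₀ hCM₀ hadd₀ hsub₀ hr₀' q hqN hmono D₀ hc
      · -- the research residue Σ★⁶ at the datum
        exact leafRankOneUpper_three_of_sigmaAtDatum_of_lowerRankZero hGZ hKo hGZK hmod hGZ73 hMN hnf hFH hL0 W₀ hCM₀ hadd₀
          hsub₀ hr₀' D₀ (fun K _ _ H ι P hK hHN _ hP hnt hodd s' hs' n d hn hℓ ↦
            hStar W₀ (W₀.conductorNorm ℤ) K D₀ H ι P hCM₀ hadd₀ hsub₀ rfl hopt hrow hSh hK hHN hP hnt hodd s' hs' n d hn hℓ)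
  -- and transport it back along `W ∼ W₀`
  exact missingUpperBoundAt_of_isIsogenous_of_analyticRank_le_one hCassels hGZK hmod (le_of_eq hr) hiso h₀

end Summit.BirchSwinnertonDyer.BirchSwinnertonDyer.Theorems.LeafShimuraInert

end
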